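import Summits.BirchSwinnertonDyer.BirchSwinnertonDyer.Theorems.SignedLowerHalvesKobayashiLowerHalfLargeImageHorocycleMuFloor
import Summits.BirchSwinnertonDyer.Rank1Residual.Supersingular.SignedLambdaParity
import Summits.BirchSwinnertonDyer.Rank1Residual.X11a.MuLambdaSplit
import HarnessLib

/-!
# Route `SignedLowerHalves`, crux 3 `KobayashiLowerHalfLargeImage` (item stmt-BirchSwinnertonDyer-19001):
# line `horocycle_mu_floor` — EXACTNESS of its certificate: at an odd good prime with `a_p = 0`,
# `HoroNonvanishing f p` ⟺ «one of Pollack's signed `p`-adic `L`-functions of `f` has `μ = 0`»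
# (cell `bsd-ssimc`, width seat `bsd-line-slh-p1-w2` gen 5, file 6; helper `--supports 19001`)

HONEST FRAMING: the crux is OPEN and nothing here proves it; BSD is not proved by any of this. THEOREMS ONLY.
CALIBRATION / SUPPORT ONLY. This closes the loop opened by p647721 (`exists_sign_hasUnitContent_kobayashiL_of_horoNonvanishing`:
certificate ⟹ one sign with `μ(L^ε_p) = 0`) with the CONVERSE: `μ(L^∓) = 0` ⟹ at every sufficiently deep level `n` of that
parity some coefficient `[T^k]θ_n(f)` is a `p`-adic unit (single-layer EXACTNESS of the b2b cell,
`lam_mazurTate_eq_of_lam_flat/sharp` in `MazurTateLayerConsistency`: `θ_n ≢ 0 (mod p)` as soon as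
`λ(L^∓) + deg ω_n^∓ < pⁿ`; the integral model of `θ_n` is p647721's `exists_integral_of_isCongrModOmega_mazurTate`).

* §1 `horoNonvanishing_of_hasUnitContent_minus/plus` — Pollack pair, `μ(L⁻) = 0` (resp. `μ(L⁺) = 0`) ⟹ the certificate at
  some even (resp. odd) level (deep levels of each parity: tree `exists_even_layer` / `exists_odd_layer`);
  `horoNonvanishing_of_exists_isSignedPAdicLFunction_hasUnitContent`.
* §2 **`horoNonvanishing_iff_exists_isSignedPAdicLFunction_hasUnitContent`**: for the newform `f` of `W` at an odd good
  prime with `a_p = 0`, `(∃ n k, [T^k]θ_n(f) ≠ 0 ∧ ord_p ≤ 0) ↔ (∃ ε L, IsSignedPAdicLFunction f p ε L ∧ HasUnitContent L)`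
  — the sketch's `HoroNonvanishing` IS «`min(μ(L_p⁺), μ(L_p⁻)) = 0`», neither weaker nor stronger (Perrin-Riou 6.1.1 /
  Pollack Conj. 6.3 / Pollack–Weston Rem. 4.2; PROVED at `p = 3` in the tree, Conjecture B⁰ at `p ≥ 5`; μ-folklore
  NEGATIVE rule: nothing on μ is asserted here beyond the equivalence).

References: [Pollack2003] Prop. 6.9, 6.10, 6.18, Cor. 5.11; [PollackWeston2011] Thm. 4.1 (1), Rem. 4.2; [Sprung2017] §3, Cor. 3.6;
[Washington1997] Prop. 7.2, §7.1; [Kobayashi2003] (3.4)–(3.6) (p. 7).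
-/

set_option autoImplicit false
set_option linter.dupNamespace false

noncomputable section

open scoped Classical MatrixGroups ModularForm

open Polynomial CongruenceSubgroup WeierstrassCurve Literature.NumberTheory.EllipticCurves
  Literature.NumberTheory.EllipticCurves.ModularForms
  Literature.NumberTheory.EllipticCurves.Rank1Residual
  Literature.NumberTheory.EllipticCurves.GreenbergVatsal2000
  Literature.NumberTheory.EllipticCurves.Kobayashi2003
  Literature.NumberTheory.EllipticCurves.Sprung2017
  Summit.BirchSwinnertonDyer.Rank1Residual.X1.MuLambda
  Summit.BirchSwinnertonDyer.Rank1Residual.Supersingular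
  Summit.BirchSwinnertonDyer.BirchSwinnertonDyer.Theorems.HorocycleMuFloor
  Summit.BirchSwinnertonDyer.BirchSwinnertonDyer.Theorems.LargeImageMuFloor

namespace Summit.BirchSwinnertonDyer.BirchSwinnertonDyer.Theorems.HorocycleMuDoor

/-! ## §1. `μ(L^∓) = 0` ⟹ the certificate at a deep level of that parity -/

section Converse

variable {W : WeierstrassCurve ℚ} [W.IsElliptic] [W.IsGloballyMinimal] {N : ℕ} [NeZero N]
  {f : CuspForm (Gamma0 N) 2} {p : ℕ} [hp : Fact p.Prime] {Lplus Lminus : IwasawaAlgebra p}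

omit [W.IsElliptic] [W.IsGloballyMinimal] [NeZero N] in
/-- From a non-zero `Θ ∈ Λ` with `ι Θ = θ_n(f)` and `μ(Θ) = 0`: a coefficient `[T^k]θ_n(f)` of norm `1`, hence `≠ 0` of
valuation `≤ 0`. [cite: GreenbergVatsal2000, p. 2, (2)] -/
theorem horoNonvanishing_of_integral_of_mu_eq_zero {n : ℕ} {Θ : IwasawaAlgebra p}
    (hΘ : iwasawaToPowerSeries p Θ = ((mazurTateElement f p n).map (algebraMap ℚ ℚ_[p]) : PowerSeries ℚ_[p]))
    (hΘ0 : Θ ≠ 0) (hμ : mu Θ = 0) :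
    ∃ k : ℕ, (mazurTateElement f p n).coeff k ≠ 0 ∧ padicValRat p ((mazurTateElement f p n).coeff k) ≤ 0 := by
  obtain ⟨k, hk⟩ := Summit.BirchSwinnertonDyer.Rank1Residual.X11a.hasUnitContent_of_mu_eq_zero hΘ0 hμ
  rw [PadicInt.isUnit_iff] at hk
  have hnorm : ‖(((mazurTateElement f p n).coeff k : ℚ) : ℚ_[p])‖ = 1 := by
    rw [← coeff_coe_map_ratCast, ← hΘ, PowerSeries.coeff_map]
    change ‖((PowerSeries.coeff k Θ : ℤ_[p]) : ℚ_[p])‖ = 1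
    rw [← PadicInt.norm_def]  -- `‖(x : ℚ_p)‖ = ‖x‖`
    exact hk
  have hp1 : (1 : ℝ) < p := by exact_mod_cast hp.out.one_lt
  have hk0 : (mazurTateElement f p n).coeff k ≠ 0 := by
    intro h0
    rw [h0, Rat.cast_zero, norm_zero] at hnorm
    exact zero_ne_one hnorm
  refine ⟨k, hk0, ?_⟩
  have hne : (((mazurTateElement f p n).coeff k : ℚ) : ℚ_[p]) ≠ 0 := by exact_mod_cast hk0
  have h1 : (1 : ℝ) ≤ ‖(((mazurTateElement f p n).coeff k : ℚ) : ℚ_[p])‖ := hnorm.ge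
  rw [Padic.norm_eq_zpow_neg_valuation hne, Padic.valuation_ratCast, one_le_zpow_iff_right₀ hp1] at h1
  linarith

/-- **`μ(L⁻) = 0` ⟹ `HoroNonvanishing` at some EVEN level** (odd good `p`, `a_p = 0`, `f` the newform of `W`, any Pollack pair):
single-layer exactness at a deep even level (`lam_mazurTate_eq_of_lam_flat`; a Pollack pair is a Sprung pair at trace `0`).
[cite: Pollack2003, Prop. 6.9, 6.10 and 6.18] [cite: Sprung2017, §3 and Cor. 3.6] -/
theorem horoNonvanishing_of_hasUnitContent_minus (hp2 : p ≠ 2) (hf : IsNewformOf W f)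
    (hgood : W.HasGoodReductionAtPrime p) (hap : W.frobeniusTrace p = 0) (hPP : IsPollackPair f p Lplus Lminus)
    (hu : HasUnitContent Lminus) :
    ∃ n k : ℕ, Even n ∧ (mazurTateElement f p n).coeff k ≠ 0 ∧ padicValRat p ((mazurTateElement f p n).coeff k) ≤ 0 := by
  have hSP : IsSprungPair f p (W.frobeniusTrace p) Lplus Lminus := by
    rw [hap]
    exact (isSprungPair_zero_iff f p Lplus Lminus).mpr ⟨hPP.2.2.1, hPP.2.2.2⟩
  have hap' : (p : ℤ) ∣ W.frobeniusTrace p := by rw [hap]; exact dvd_zero _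
  have hμL : mu Lminus = 0 := Summit.BirchSwinnertonDyer.Rank1Residual.X11a.mu_eq_zero_of_hasUnitContent hu
  obtain ⟨n, hn, hlt⟩ := exists_even_layer p (lam Lminus)
  obtain ⟨R, ρ, -, hθR, -⟩ := exists_integral_of_isCongrModOmega_mazurTate (hPP.2.2.2 n hn)
  obtain ⟨hΘ0, hμ, -⟩ := lam_mazurTate_eq_of_lam_flat hp2 hf hgood hap' hSP hPP.2.1 hμL hn hlt hθR.symm
  obtain ⟨k, hk⟩ := horoNonvanishing_of_integral_of_mu_eq_zero hθR.symm hΘ0 hμ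
  exact ⟨n, k, hn, hk⟩

/-- **`μ(L⁺) = 0` ⟹ `HoroNonvanishing` at some ODD level.** [cite: Pollack2003, Prop. 6.9, 6.10 and 6.18] [cite: Sprung2017, §3 and Cor. 3.6] -/
theorem horoNonvanishing_of_hasUnitContent_plus (hp2 : p ≠ 2) (hf : IsNewformOf W f)
    (hgood : W.HasGoodReductionAtPrime p) (hap : W.frobeniusTrace p = 0) (hPP : IsPollackPair f p Lplus Lminus)
    (hu : HasUnitContent Lplus) :
    ∃ n k : ℕ, Odd n ∧ (mazurTateElement f p n).coeff k ≠ 0 ∧ padicValRat p ((mazurTateElement f p n).coeff k) ≤ 0 := by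
  have hSP : IsSprungPair f p (W.frobeniusTrace p) Lplus Lminus := by
    rw [hap]
    exact (isSprungPair_zero_iff f p Lplus Lminus).mpr ⟨hPP.2.2.1, hPP.2.2.2⟩
  have hap' : (p : ℤ) ∣ W.frobeniusTrace p := by rw [hap]; exact dvd_zero _
  have hμL : mu Lplus = 0 := Summit.BirchSwinnertonDyer.Rank1Residual.X11a.mu_eq_zero_of_hasUnitContent hu
  obtain ⟨n, hn, hlt⟩ := exists_odd_layer p (lam Lplus)
  obtain ⟨R, ρ, -, hθR, -⟩ := exists_integral_of_isCongrModOmega_mazurTate (hPP.2.2.1 n hn)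
  obtain ⟨hΘ0, hμ, -⟩ := lam_mazurTate_eq_of_lam_sharp hp2 hf hgood hap' hSP hPP.1 hμL hn hlt hθR.symm
  obtain ⟨k, hk⟩ := horoNonvanishing_of_integral_of_mu_eq_zero hθR.symm hΘ0 hμ
  exact ⟨n, k, hn, hk⟩

/-- **One signed function with `μ = 0` ⟹ `HoroNonvanishing f p`** (odd good `p`, `a_p = 0`, newform `f` of `W`; the Pollack
pair exists by Pollack's theorem PROVED in the tree and carries the unit content by uniqueness — w6's dictionary).
[cite: Pollack2003, Thm. 5.6, Cor. 5.11, Prop. 6.9, 6.10 and 6.18] [cite: Kobayashi2003, (3.4)–(3.6) (p. 7)] -/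
theorem horoNonvanishing_of_exists_isSignedPAdicLFunction_hasUnitContent (hp2 : p ≠ 2) (hf : IsNewformOf W f)
    (hgood : W.HasGoodReductionAtPrime p) (hap : W.frobeniusTrace p = 0)
    (h : ∃ (ε : ℤˣ) (L : IwasawaAlgebra p), IsSignedPAdicLFunction f p ε L ∧ HasUnitContent L) :
    ∃ n k : ℕ, (mazurTateElement f p n).coeff k ≠ 0 ∧ padicValRat p ((mazurTateElement f p n).coeff k) ≤ 0 := by
  obtain ⟨ε, hε⟩ := exists_sign_forall_isPollackPair_hasUnitContent h
  obtain ⟨Lplus, Lminus, hPP⟩ :=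
    exists_isPollackPair (pollack_exists_plusMinusPAdicLFunction_holds (W := W) (f := f) (p := p)) hp2 hf hgood hap
  have hu := hε Lplus Lminus hPP
  rcases Int.units_eq_one_or ε with rfl | rfl
  · rw [kobayashiL, if_pos rfl] at hu
    obtain ⟨n, k, -, hk⟩ := horoNonvanishing_of_hasUnitContent_minus hp2 hf hgood hap hPP hu
    exact ⟨n, k, hk⟩
  · have h1 : ((-1 : ℤˣ) = 1) ↔ False := by decide
    rw [kobayashiL, if_neg h1.mp] at hu
    obtain ⟨n, k, -, hk⟩ := horoNonvanishing_of_hasUnitContent_plus hp2 hf hgood hap hPP hu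
    exact ⟨n, k, hk⟩

/-! ## §2. The equivalence -/

/-- **EXACTNESS of the horocycle certificate**: for the newform `f` of `W` at an odd good prime `p` with `a_p = 0`,
`HoroNonvanishing f p` (some `[T^k]θ_n(f) ≠ 0` of valuation `≤ 0`) ⟺ one of Pollack's signed `p`-adic `L`-functions of `f`
has unit content (`min(μ(L_p⁺), μ(L_p⁻)) = 0`). `→`: p647721 + p648511's converse currency; `←`: §1. So the line's
`HoroNonvanishing` / `SignedMuFloorW` pieces are EXACTLY the one-sign μ-statement (PROVED at `p = 3`, B⁰ at `p ≥ 5`),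
neither weaker nor stronger. [cite: Pollack2003, Prop. 6.9, 6.10, 6.18 and Cor. 5.11] [cite: PollackWeston2011, Thm. 4.1 (1), Rem. 4.2] -/
theorem horoNonvanishing_iff_exists_isSignedPAdicLFunction_hasUnitContent (hp2 : p ≠ 2) (hf : IsNewformOf W f)
    (hgood : W.HasGoodReductionAtPrime p) (hap : W.frobeniusTrace p = 0) :
    (∃ n k : ℕ, (mazurTateElement f p n).coeff k ≠ 0 ∧ padicValRat p ((mazurTateElement f p n).coeff k) ≤ 0) ↔
      ∃ (ε : ℤˣ) (L : IwasawaAlgebra p), IsSignedPAdicLFunction f p ε L ∧ HasUnitContent L :=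
  ⟨fun h ↦ exists_isSignedPAdicLFunction_of_exists_sign_forall_isPollackPair hp2 hf hgood hap
      (exists_sign_hasUnitContent_kobayashiL_of_horoNonvanishing h),
    horoNonvanishing_of_exists_isSignedPAdicLFunction_hasUnitContent hp2 hf hgood hap⟩

end Converse

end Summit.BirchSwinnertonDyer.BirchSwinnertonDyer.Theorems.HorocycleMuDoor

end
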